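import Literature.Barriers.CriticalPhenomena.RigorousRGSmallParameterCovarianceDecomposition
import HarnessLib

/-!
# `RigorousRGSmallParameter` (Slade, Theorem 1.4.1): the decay of the massive fractional
# covariance, Lemma 3.3.2 — `((-Δ_{ℤ^d})^{α/2}+m²)⁻¹_{0,x} ≤ c|x|^{-(d-α)}(1+m⁴|x|^{2α})⁻¹`

Companion of `RigorousRGSmallParameterCovarianceDecomposition.lean` ((3.7) on `ℤ^d`:
`((-Δ)^{α/2}+m²)⁻¹_{x,0} = Σ_jC_{j;0,x}`) and `RigorousRGSmallParameterCovarianceBound.lean`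
((3.9)) in the proof architecture of the barrier `RigorousRGSmallParameter.lean`. Source:
G. Slade, *Critical exponents for long-range `O(n)` models below the upper critical dimension*,
Commun. Math. Phys. 358 (2018) 343–436, Lemma 3.3.2: "For `d ≥ 1`, `α ∈ (0,2∧d)`, `m̄² > 0`,
`m² ∈ [0,m̄²]`, and `x ≠ 0`, (3.11) `((-Δ_{ℤ^d})^{α/2}+m²)⁻¹_{0,x} ≤ c (1/|x|^{d-α})
(1/(1+m⁴|x|^{2α}))`, with `c` depending on `m̄²`" and its proof: "we take `L = 3` (this arbitrary
choice shows that `c` is independent of `L`). Given `x ∈ ℤ^d`, let `j_x` be the nonnegative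
integer for which `½L^{j_x} ≤ |x| < ½L^{j_x+1}`. By Proposition 3.3.1, `C_{j;0,x} = 0` when
`j ≤ j_x`. By (3.9), with a constant `c` that may change from one occurrence to the next,
`((-Δ)^{α/2}+m²)⁻¹_{0,x} ≤ cΣ_{j=j_x+1}^∞ (1+m⁴L^{2α(j-1)})⁻¹L^{-(d-α)(j-1)} ≤
c(1+m⁴L^{2αj_x})⁻¹L^{-(d-α)j_x} ≤ c (1/|x|^{d-α})(1/(1+m⁴|x|^{2α}))`."

## What this file proves (everything; no definition and no named fact is introduced)

* `FRD.fracCov_eq_zero_of_le` — `C_{j;0,x}(m²) = 0` when `½L^j ≤ |x|₁` (finite range).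
* `FRD.second_term_le` — for `m² ≤ m̄²` the second term of (10.3) at `p' = 2α` is at most
  `2(1+m̄²)×` the first.
* **`FRD.Slade2017_lem332`** — **Lemma 3.3.2, PROVED for `m² ∈ (0,m̄²]`** and the explicit
  decomposition, in the `ℓ¹` norm `|x|₁ = Σ_i|x_i|` (which is `≥` the Euclidean norm, so this form
  implies the Euclidean one): there is `c > 0` depending on `d, α, m̄²` only such that
  `((-Δ_{ℤ^d})^{α/2}+m²)⁻¹_{x,0} ≤ c |x|₁^{α-d} / (1+m⁴|x|₁^{2α})` for all `m² ∈ (0,m̄²]`, `x ≠ 0`.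
  Scope: the case `m² = 0` of the printed lemma is not treated (the identity
  `Σ_jC_j = ((-Δ)^{α/2}+m²)⁻¹` is available for `m² > 0`).
-/

noncomputable section

namespace Literature.Barriers.CriticalPhenomena

open _root_.MeasureTheory Set Filter
open scoped _root_.Topology Real

namespace LongRangePhi4

namespace FRD

open Literature.Probability.LatticeModels

variable {d : ℕ}

/-- **`C_{j;0,x}(m²) = 0` when `½L^j ≤ |x|₁`** ("By Proposition 3.3.1, `C_{j;0,x} = 0` when
`j ≤ j_x`"). [cite: Slade2017, Lemma 3.3.2 (proof) and Proposition 3.3.1 (range ½L^j)] -/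
theorem fracCov_eq_zero_of_le (hd : 1 ≤ d) {L : ℝ} (hL : 0 ≤ L) (α m2 : ℝ) (j : ℕ) (x : Site d)
    (hx : L ^ j / 2 ≤ ((∑ i, (x i).natAbs : ℕ) : ℝ)) : fracCov d L α m2 j x = 0 := by
  unfold fracCov
  rw [setIntegral_congr_fun measurableSet_Ioi (g := fun _ => (0 : ℝ)) fun s hs => by
    simp only
    rw [Gam_eq_zero hd hL (le_of_lt hs) j x hx, zero_mul]]
  simp

/-- For `m² ≤ m̄²` the second term of (10.3) (at `p' = 2α`) is dominated by the first:
`1/(1+m²ℓ^{2α}) ≤ 2(1+m̄²)/(1+m⁴ℓ^{2α})` (`ℓ ≥ 1`). [cite: Slade2017, §10.1 ("Since we assume m² ≤ m̄², the second term … is dominated by the first term")] -/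
theorem second_term_le {ℓ : ℝ} (hℓ : 1 ≤ ℓ) {α : ℝ} (hα : 0 ≤ α) {m2 mbar : ℝ} (hm2 : 0 ≤ m2)
    (hm2' : m2 ≤ mbar) :
    1 / (1 + m2 * ℓ ^ (2 * α)) ≤ 2 * (1 + mbar) * (1 / (1 + m2 ^ 2 * ℓ ^ (2 * α))) := by
  have hℓ0 : 0 < ℓ := by linarith
  have hX1 : 1 ≤ ℓ ^ α := Real.one_le_rpow hℓ hα
  have hX0 : 0 < ℓ ^ α := by linarith
  have h2α : ℓ ^ (2 * α) = (ℓ ^ α) ^ 2 := by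
    rw [← Real.rpow_natCast (ℓ ^ α) 2, ← Real.rpow_mul hℓ0.le]
    congr 1
    push_cast
    ring
  rw [h2α]
  set A : ℝ := m2 * ℓ ^ α with hA
  have hA0 : 0 ≤ A := by positivity
  have hm2A : m2 ^ 2 * (ℓ ^ α) ^ 2 = A ^ 2 := by rw [hA]; ring
  rw [hm2A, mul_one_div, div_le_div_iff₀ (by positivity) (by positivity), one_mul]
  have e : A ^ 2 = m2 * (m2 * (ℓ ^ α) ^ 2) := by rw [hA]; ring
  have hY : 0 ≤ m2 * (ℓ ^ α) ^ 2 := by positivity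
  have hA2 : A ^ 2 ≤ mbar * (m2 * (ℓ ^ α) ^ 2) := by
    rw [e]
    exact mul_le_mul_of_nonneg_right hm2' hY
  have hmbar0 : 0 ≤ mbar := hm2.trans hm2'
  nlinarith [hA2, hY, mul_nonneg hmbar0 hY, hmbar0]

/-- **Slade, Lemma 3.3.2, PROVED (for `m² ∈ (0,m̄²]`, `ℓ¹` norm)**: for `d ≥ 1`, `α ∈ (0,2∧d)`
and `m̄² > 0` there is `c > 0` depending only on these such that for all `m² ∈ (0,m̄²]` and
`x ≠ 0`, `((-Δ_{ℤ^d})^{α/2}+m²)⁻¹_{x,0} ≤ c |x|₁^{α-d}/(1+m⁴|x|₁^{2α})` — "the lemma implies an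
upper bound `O(m⁻⁴|x|^{-(d+α)})`, which has best possible power of `|x|`". Printed proof,
followed with `L = 3`: `j_x` with `3^{j_x} ≤ 2|x|₁ < 3^{j_x+1}`; `C_{j;0,x} = 0` for `j ≤ j_x`
(finite range); (3.9) for `j > j_x` and the geometric sum `Σ_{j>j_x}3^{-(d-α)(j-1)}`.
[cite: Slade2017, Lemma 3.3.2 (display (3.11)) and its proof] -/
theorem Slade2017_lem332 (hd : 1 ≤ d) {α : ℝ} (hα0 : 0 < α) (hα2 : α < 2) (hαd : α < d)
    {mbar : ℝ} (hmbar : 0 < mbar) :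
    ∃ c : ℝ, 0 < c ∧ ∀ m2 : ℝ, 0 < m2 → m2 ≤ mbar → ∀ x : Site d, x ≠ 0 →
      fracResolventZd d (α / 2) m2 x 0 ≤
        c * (((∑ i, (x i).natAbs : ℕ) : ℝ)) ^ (α - d) *
          (1 / (1 + m2 ^ 2 * (((∑ i, (x i).natAbs : ℕ) : ℝ)) ^ (2 * α))) := by
  obtain ⟨c₀, hc₀, hB⟩ := Slade2017_prop331_estimate hd hα0 hα2 hαd (p' := 2 * α) (by positivity)
  -- geometric ratio `3^{α-d} < 1`
  have hq1 : (3 : ℝ) ^ (α - d) < 1 := Real.rpow_lt_one_of_one_lt_of_neg (by norm_num) (by linarith)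
  have hq0 : 0 ≤ (3 : ℝ) ^ (α - d) := Real.rpow_nonneg (by norm_num) _
  obtain ⟨K, hK⟩ : ∃ K : ℝ, K = c₀ * (1 + 2 * (1 + mbar)) / (1 - (3 : ℝ) ^ (α - d)) *
      ((2 / 3 : ℝ) ^ (α - d) * (3 / 2 : ℝ) ^ (2 * α)) := ⟨_, rfl⟩
  have hK0 : 0 < K := by
    rw [hK]
    have : 0 < 1 - (3 : ℝ) ^ (α - d) := by linarith
    positivity
  refine ⟨K, hK0, fun m2 hm2 hm2' x hx => ?_⟩
  -- `n = |x|₁ ≥ 1`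
  set n : ℕ := ∑ i, (x i).natAbs with hn
  have hn1 : 1 ≤ n := by
    by_contra h
    have h0 : n = 0 := by omega
    apply hx
    funext i
    have : (x i).natAbs = 0 := by
      have := Finset.sum_eq_zero_iff.1 h0 i (Finset.mem_univ i)
      exact this
    exact Int.natAbs_eq_zero.1 this
  have hnr : (1 : ℝ) ≤ n := by exact_mod_cast hn1
  have hnr0 : (0 : ℝ) < n := by linarith
  -- `j_x`: `3^{jx} ≤ 2n < 3^{jx+1}`
  set jx : ℕ := Nat.log 3 (2 * n) with hjx
  have hjx1 : 3 ^ jx ≤ 2 * n := Nat.pow_log_le_self 3 (by omega)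
  have hjx2 : 2 * n < 3 ^ (jx + 1) := Nat.lt_pow_succ_log_self (by norm_num) _
  have hjx1r : (3 : ℝ) ^ jx ≤ 2 * n := by exact_mod_cast hjx1
  have hjx2r : 2 * (n : ℝ) < 3 ^ (jx + 1) := by exact_mod_cast hjx2
  set ℓ₀ : ℝ := (3 : ℝ) ^ jx with hℓ₀
  have hℓ₀1 : 1 ≤ ℓ₀ := one_le_pow₀ (by norm_num)
  have hℓ₀0 : 0 < ℓ₀ := by linarith
  have hℓ₀n : 2 / 3 * (n : ℝ) ≤ ℓ₀ := by
    rw [pow_succ] at hjx2r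
    linarith
  -- the decomposition `C = Σ_j C_j` at `L = 3`
  have hsum := Slade2017_display37_Zd hd hα0 hα2 (by norm_num : (1 : ℝ) < 3) hm2 x
  have hzero : ∀ m : ℕ, m < jx → fracCov d 3 α m2 (m + 1) x = 0 := by
    intro m hm
    refine fracCov_eq_zero_of_le hd (by norm_num) α m2 (m + 1) x ?_
    have h1 : (3 : ℝ) ^ (m + 1) ≤ 3 ^ jx := pow_le_pow_right₀ (by norm_num) (by omega)
    rw [← hn]
    linarith
  -- the bound on the non-vanishing terms `j = jx + 1 + k`
  have hterm : ∀ k : ℕ, |fracCov d 3 α m2 (k + jx + 1) x| ≤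
      c₀ * (1 + 2 * (1 + mbar)) * (ℓ₀ ^ (α - d) * (1 / (1 + m2 ^ 2 * ℓ₀ ^ (2 * α)))) *
        ((3 : ℝ) ^ (α - d)) ^ k := by
    intro k
    have h := hB 3 (by norm_num) m2 hm2.le (k + jx + 1) (by omega) x
    have hℓ : (3 : ℝ) ^ (k + jx + 1 - 1) = 3 ^ k * ℓ₀ := by
      rw [show k + jx + 1 - 1 = k + jx from by omega, pow_add]
    rw [hℓ] at h
    have hℓk1 : 1 ≤ (3 : ℝ) ^ k := one_le_pow₀ (by norm_num)
    have hℓk0 : 0 < (3 : ℝ) ^ k := by linarith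
    have hL1 : 1 ≤ 3 ^ k * ℓ₀ := one_le_mul_of_one_le_of_one_le hℓk1 hℓ₀1
    have hL0 : 0 < 3 ^ k * ℓ₀ := by linarith
    -- second term dominated by the first
    have h2nd := second_term_le hL1 (by positivity : 0 ≤ α) hm2.le hm2'
    -- monotonicity in `ℓ`: replace `3^k ℓ₀` by `ℓ₀` in the first term, split the power
    have hmono : 1 / (1 + m2 ^ 2 * (3 ^ k * ℓ₀) ^ (2 * α)) ≤ 1 / (1 + m2 ^ 2 * ℓ₀ ^ (2 * α)) := by
      refine one_div_le_one_div_of_le (by positivity) ?_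
      have : ℓ₀ ^ (2 * α) ≤ (3 ^ k * ℓ₀) ^ (2 * α) :=
        Real.rpow_le_rpow hℓ₀0.le (le_mul_of_one_le_left hℓ₀0.le hℓk1) (by positivity)
      nlinarith [sq_nonneg m2]
    have hpow : (3 ^ k * ℓ₀) ^ (α - d) = ((3 : ℝ) ^ (α - d)) ^ k * ℓ₀ ^ (α - d) := by
      rw [Real.mul_rpow hℓk0.le hℓ₀0.le, ← Real.rpow_natCast (3 : ℝ) k, ← Real.rpow_mul (by norm_num),
        ← Real.rpow_natCast ((3 : ℝ) ^ (α - d)) k, ← Real.rpow_mul (by norm_num)]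
      congr 1
      rw [mul_comm]
    have hfirst0 : 0 ≤ 1 / (1 + m2 ^ 2 * (3 ^ k * ℓ₀) ^ (2 * α)) := by positivity
    calc |fracCov d 3 α m2 (k + jx + 1) x|
        ≤ c₀ * (3 ^ k * ℓ₀) ^ (α - d) * (1 / (1 + m2 ^ 2 * (3 ^ k * ℓ₀) ^ (2 * α)) +
            1 / (1 + m2 * (3 ^ k * ℓ₀) ^ (2 * α))) := h
      _ ≤ c₀ * (3 ^ k * ℓ₀) ^ (α - d) * ((1 + 2 * (1 + mbar)) *
            (1 / (1 + m2 ^ 2 * (3 ^ k * ℓ₀) ^ (2 * α)))) := by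
          refine mul_le_mul_of_nonneg_left ?_ (mul_nonneg hc₀.le (Real.rpow_nonneg hL0.le _))
          linarith
      _ ≤ c₀ * (3 ^ k * ℓ₀) ^ (α - d) * ((1 + 2 * (1 + mbar)) * (1 / (1 + m2 ^ 2 * ℓ₀ ^ (2 * α)))) := by
          refine mul_le_mul_of_nonneg_left (mul_le_mul_of_nonneg_left hmono (by positivity))
            (mul_nonneg hc₀.le (Real.rpow_nonneg hL0.le _))
      _ = c₀ * (1 + 2 * (1 + mbar)) * (ℓ₀ ^ (α - d) * (1 / (1 + m2 ^ 2 * ℓ₀ ^ (2 * α)))) *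
            ((3 : ℝ) ^ (α - d)) ^ k := by rw [hpow]; ring
  -- summation
  obtain ⟨G, hG⟩ : ∃ G : ℝ, G = c₀ * (1 + 2 * (1 + mbar)) *
      (ℓ₀ ^ (α - d) * (1 / (1 + m2 ^ 2 * ℓ₀ ^ (2 * α)))) := ⟨_, rfl⟩
  have hG0 : 0 ≤ G := by
    rw [hG]
    have := Real.rpow_nonneg hℓ₀0.le (α - d)
    positivity
  have hgeom := summable_geometric_of_lt_one hq0 hq1
  have hshift : HasSum (fun k : ℕ => fracCov d 3 α m2 (k + jx + 1) x) (fracResolventZd d (α / 2) m2 x 0) := by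
    have h1 := (hasSum_nat_add_iff' jx).2 hsum
    have h0 : ∑ i ∈ Finset.range jx, fracCov d 3 α m2 (i + 1) x = 0 :=
      Finset.sum_eq_zero fun i hi => hzero i (Finset.mem_range.1 hi)
    rw [h0, sub_zero] at h1
    exact h1
  calc fracResolventZd d (α / 2) m2 x 0 = ∑' k : ℕ, fracCov d 3 α m2 (k + jx + 1) x := hshift.tsum_eq.symm
    _ ≤ ∑' k : ℕ, G * ((3 : ℝ) ^ (α - d)) ^ k := by
        refine hshift.summable.tsum_le_tsum (fun k => (le_abs_self _).trans ?_) (hgeom.mul_left G)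
        rw [hG]
        exact hterm k
    _ = G * (1 - (3 : ℝ) ^ (α - d))⁻¹ := by rw [tsum_mul_left, tsum_geometric_of_lt_one hq0 hq1]
    _ ≤ K * ((n : ℝ)) ^ (α - d) * (1 / (1 + m2 ^ 2 * (n : ℝ) ^ (2 * α))) := by
        -- `ℓ₀ ≥ (2/3) n`: `ℓ₀^{α-d} ≤ (2/3)^{α-d} n^{α-d}` and `1/(1+m⁴ℓ₀^{2α}) ≤ (3/2)^{2α}/(1+m⁴n^{2α})`
        have h1 : ℓ₀ ^ (α - d) ≤ (2 / 3 : ℝ) ^ (α - d) * (n : ℝ) ^ (α - d) := by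
          rw [← Real.mul_rpow (by norm_num) hnr0.le]
          exact Real.rpow_le_rpow_of_nonpos (by positivity) hℓ₀n (by linarith)
        have h2 : 1 / (1 + m2 ^ 2 * ℓ₀ ^ (2 * α)) ≤ (3 / 2 : ℝ) ^ (2 * α) * (1 / (1 + m2 ^ 2 * (n : ℝ) ^ (2 * α))) := by
          have h32 : 1 ≤ (3 / 2 : ℝ) ^ (2 * α) := Real.one_le_rpow (by norm_num) (by positivity)
          have hℓ2 : (2 / 3 : ℝ) ^ (2 * α) * (n : ℝ) ^ (2 * α) ≤ ℓ₀ ^ (2 * α) := by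
            rw [← Real.mul_rpow (by norm_num) hnr0.le]
            exact Real.rpow_le_rpow (by positivity) hℓ₀n (by positivity)
          have h23 : (3 / 2 : ℝ) ^ (2 * α) * (2 / 3 : ℝ) ^ (2 * α) = 1 := by
            rw [← Real.mul_rpow (by norm_num) (by norm_num)]
            norm_num
          rw [mul_one_div, div_le_div_iff₀ (by positivity) (by positivity), one_mul]
          have hn2 : 0 ≤ (n : ℝ) ^ (2 * α) := Real.rpow_nonneg hnr0.le _
          nlinarith [mul_nonneg (sq_nonneg m2) hn2, mul_le_mul_of_nonneg_left hℓ2 (sq_nonneg m2)]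
        have h3 : 0 < 1 - (3 : ℝ) ^ (α - d) := by linarith
        have hn3 : 0 ≤ (n : ℝ) ^ (α - d) := Real.rpow_nonneg hnr0.le _
        calc G * (1 - (3 : ℝ) ^ (α - d))⁻¹
            = c₀ * (1 + 2 * (1 + mbar)) / (1 - (3 : ℝ) ^ (α - d)) *
                (ℓ₀ ^ (α - d) * (1 / (1 + m2 ^ 2 * ℓ₀ ^ (2 * α)))) := by rw [hG]; ring
          _ ≤ c₀ * (1 + 2 * (1 + mbar)) / (1 - (3 : ℝ) ^ (α - d)) *
                (((2 / 3 : ℝ) ^ (α - d) * (n : ℝ) ^ (α - d)) *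
                  ((3 / 2 : ℝ) ^ (2 * α) * (1 / (1 + m2 ^ 2 * (n : ℝ) ^ (2 * α))))) := by
              refine mul_le_mul_of_nonneg_left (mul_le_mul h1 h2 (by positivity) (by positivity))
                (by positivity)
          _ = K * (n : ℝ) ^ (α - d) * (1 / (1 + m2 ^ 2 * (n : ℝ) ^ (2 * α))) := by rw [hK]; ring

end FRD

end LongRangePhi4

end Literature.Barriers.CriticalPhenomena
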